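import Summits.AtomisticToContinuum.Crystallization.Theorems.FrustratedLawDichotomyAtlasReachSharing
import Summits.AtomisticToContinuum.Crystallization.Theorems.FrustratedLawDichotomyTransportPriceFinite

/-!
# FrustratedLawDichotomy · crux `AperiodicFrustratedLawGap` (stmt-AtomisticToContinuum-27623) — THE BALANCED SHARING LEDGER:
# floors and cap read on the SENDER-NORMALISED SHARE of site energies, WITHOUT the `c₀`-shift (decomp-a2c, hand-1 g59, K2 analytic lane;
# companion and repair of #134 `…AtlasReachSharing`)

#134 identifies, for the ONE-SIDED sharing transport `F` of the shifted energy `rootEnergy + c₀` (`c₀ = (250/12)(10/7)⁶ ≈ 177.08`), the transported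
root energy with `ballAvgEnergy r μ = Σ_{atoms y ∈ B̄_r(0)} (e(θ_y μ) + c₀)/N_r(y) − c₀`, `N_r(y) = #(atoms of μ in B̄_r(y))`.  EXACT BOOKKEEPING
(`ballAvgEnergy_eq_shareAvgEnergy_add`):
  `ballAvgEnergy r μ = shareAvgEnergy r μ + c₀ · (ballWeight r μ − 1)`,  `shareAvgEnergy r μ = Σ_y e(θ_y μ)/N_r(y)`,  `ballWeight r μ = Σ_{y ∈ B̄_r(0)} 1/N_r(y)`,
so the shift cancels ONLY on coordination-homogeneous balls (`ballWeight = 1`), and every inhomogeneity is AMPLIFIED by `c₀ ≈ 177`: e.g. fcc with one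
vacancy, rooted at a neighbour of the vacancy, `r = 11/10`: `N(root) = 12`, the 4 common neighbours `N = 12`, the other 7 `N = 13`, `ballWeight − 1 =
5/12 + 7/13 − 1 = −7/156`, `c₀·(−7/156) ≈ −7.95` ⇒ `ballAvgEnergy ≈ −8.6` and the cap slot of #134 `coherentMassExclusion_of_ballAvg` needs `D ≳ 7.9`
there (desk arithmetic; fcc + vacancy is 7/10-hard-core, off every fcc-window row, and weakly Nash — each move into the vacancy is an exact tie by the
point reflection through the bond midpoint).  THE REPAIR (this file): use the TWO-SIDED ledger of `…SignedLedger.net` — `F` = the tree's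
`sharing_transport` of the measurable surrogate of `rootEnergy + c₀`, AND `G` = the `sharing_transport` of the CONSTANT `c₀` — so that
  `rootEnergy μ + net F G μ = shareAvgEnergy r μ`   EXACTLY at every rooted `7/10`-hard-core `μ` (`transported_eq_shareAvgEnergy`),
with no `c₀` term left (at the vacancy root above `shareAvgEnergy ≈ −0.669`, deficit `≈ −0.05`).  `net F G` is an admissible null ledger
(`balanced_nullLedger`: out-flows `≤ C₀ + c₀` and `= c₀`, #132 `net_nullLedger` by name), hence the three #132 junctions in SHARE currency:
★★ `coherentMassExclusion_of_shareAvg`, ★ `aperiodicFrustratedLawGap_of_offAtlasMassGap_shareAvg`, ★ `offAtlasMass_ge_of_shareAvg` (any `r > 0`).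
§3 EVALUATION on counting configurations (`shareAvgEnergy_eq_sum`, `ballWeight_eq_sum`, `ballAvgEnergy_eq_sum`): on `count|S` (`0 ∈ S`, `S`
`7/10`-separated) the three functionals ARE the displayed finite sums over `B̄_r(0) ∩ S` with `N_r(y) = (B̄_r(y) ∩ S).ncard` — the form a certificate
file (row floor / cap for a configuration class) consumes.
HONEST LABELS: bookkeeping/junction only — no numeric `D` is claimed; A(η) untouched; DESK CAVEAT (not typed): any `11/10`-local average is exposed to
the clean-shell + jammed-halo family of critic r1935 (A) if that family is literal-Nash, so the radius `r` is left free.  Two plain real-valued `def`s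
(`shareAvgEnergy`, `ballWeight`; no Prop-def, no instance / notation / option); imports TREE #134 + gen-3 `…TransportPriceFinite` (re-rooted ball
count `map_sub_apply_closedBall`, reused by the gate's dedup rule) only; 0 sorry.
Tags: [new: junction] for §1–§2, [folklore] for §3; the transports are [folklore, on tree].
-/

noncomputable section

namespace Summit.AtomisticToContinuum.Crystallization.Theorems.FrustratedLawDichotomyAtlasReachSharingBalanced

open MeasureTheory Metric Set Filter
open scoped ENNReal BigOperators
open Literature.MathematicalPhysics.StatisticalMechanics Literature.Probability.Process
open Literature.Probability.Process.LocalConfig (finite_inter_of_separated)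
open Summit.AtomisticToContinuum.Crystallization.Theorems.ChargedEnergyGapNegative (E3 eStar)
open Summit.AtomisticToContinuum.Crystallization.Theorems.FrustratedLawDichotomySignedLedger (net)
open Summit.AtomisticToContinuum.Crystallization.Theorems.FrustratedLawDichotomyTransportPriceLocal (rootEnergy_add_c0_nonneg rootEnergy_le_C0)
open Summit.AtomisticToContinuum.Crystallization.Theorems.FrustratedLawDichotomyTransportPriceSurplus
  (sharing_transport exists_measurable_rootEnergy_surrogate)
open Summit.AtomisticToContinuum.Crystallization.Theorems.FrustratedLawDichotomyAtlasReach
  (reach CoherentMassExclusion OffAtlasMassGap aperiodicFrustratedLawGap_of_massSplit)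
open Summit.AtomisticToContinuum.Crystallization.Theorems.FrustratedLawDichotomyAtlasReachLedger
  (net_nullLedger coherentMassExclusion_of_floorsL offAtlasMass_ge_of_floorsL)
open Summit.AtomisticToContinuum.Crystallization.Theorems.FrustratedLawDichotomyAtlasReachSharing
  (ballAvgEnergy ae_apply_singleton_ne_zero)
open Summit.AtomisticToContinuum.Crystallization.Theorems.FrustratedLawDichotomyTransportPriceFinite (map_sub_apply_closedBall)

/-! ## §1. The sender-normalised share of site energies and the balanced ledger -/

/-- ★ THE SENDER-NORMALISED SHARE OF SITE ENERGIES at radius `r`: `Σ_{atoms y ∈ B̄_r(0)} e(θ_y μ)/N_r(y)`, written (exactly as the difference of the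
in-flows of the two sharing transports) as `∫⁻_{B̄_r(0)} ofReal(e(θ_y μ)+c₀)/(θ_y μ)(B̄_r(0)) dμ − ∫⁻_{B̄_r(0)} ofReal(c₀)/(θ_y μ)(B̄_r(0)) dμ` (both `toReal`).
No `c₀` survives on counting configurations (`shareAvgEnergy_eq_sum`). [new: functional] -/
def shareAvgEnergy (r : ℝ) (μ : Measure E3) : ℝ :=
  (∫⁻ y in closedBall (0 : E3) r, ENNReal.ofReal (rootEnergy lennardJones (μ.map fun z : E3 => z - y) + 250 / 12 * (10 / 7) ^ 6) /
      (μ.map fun z : E3 => z - y) (closedBall (0 : E3) r) ∂μ).toReal -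
    (∫⁻ y in closedBall (0 : E3) r, ENNReal.ofReal (250 / 12 * (10 / 7) ^ 6) / (μ.map fun z : E3 => z - y) (closedBall (0 : E3) r) ∂μ).toReal

/-- The BALL WEIGHT `Σ_{atoms y ∈ B̄_r(0)} 1/N_r(y)` (`= 1` exactly on coordination-homogeneous balls). [new: functional] -/
def ballWeight (r : ℝ) (μ : Measure E3) : ℝ :=
  (∫⁻ y in closedBall (0 : E3) r, ((μ.map fun z : E3 => z - y) (closedBall (0 : E3) r))⁻¹ ∂μ).toReal

/-- ★ THE DIAGNOSTIC IDENTITY for #134: `ballAvgEnergy r μ = shareAvgEnergy r μ + c₀ · (ballWeight r μ − 1)` for EVERY measure `μ` — the `c₀`-shift of the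
one-sided sharing ledger survives as `c₀ ≈ 177` times the coordination inhomogeneity `ballWeight − 1`. [new: bookkeeping] -/
theorem ballAvgEnergy_eq_shareAvgEnergy_add (r : ℝ) (μ : Measure E3) :
    ballAvgEnergy r μ = shareAvgEnergy r μ + 250 / 12 * (10 / 7) ^ 6 * (ballWeight r μ - 1) := by
  have hc : (0 : ℝ) ≤ 250 / 12 * (10 / 7) ^ 6 := by positivity
  have hconst : (∫⁻ y in closedBall (0 : E3) r, ENNReal.ofReal (250 / 12 * (10 / 7) ^ 6) /
      (μ.map fun z : E3 => z - y) (closedBall (0 : E3) r) ∂μ).toReal = 250 / 12 * (10 / 7) ^ 6 * ballWeight r μ := by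
    unfold ballWeight
    simp only [ENNReal.div_eq_inv_mul]
    rw [lintegral_mul_const' _ _ ENNReal.ofReal_ne_top, ENNReal.toReal_mul, ENNReal.toReal_ofReal hc, mul_comm]
  unfold ballAvgEnergy shareAvgEnergy
  rw [hconst]
  ring

/-- ★ THE IDENTITY: for `F` with the two clauses of `sharing_transport` for the surrogate `H` of `rootEnergy + c₀` and `G` with the two clauses of
`sharing_transport` for the constant `c₀`, the transported root energy `rootEnergy μ + net F G μ` IS `shareAvgEnergy r μ`, at every rooted
`7/10`-hard-core `μ` — no shift term. [new: bookkeeping] -/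
theorem transported_eq_shareAvgEnergy {r : ℝ} {H : Measure E3 → ℝ}
    (hH : ∀ ν : Measure E3, IsRootedHardCore (7 / 10) ν → H ν = rootEnergy lennardJones ν - (-(250 / 12 * (10 / 7) ^ 6)))
    {F : Measure E3 → E3 → ℝ≥0∞} (houtF : ∀ ν : Measure E3, IsRootedHardCore (7 / 10) ν → ∫⁻ y, F ν y ∂ν = ENNReal.ofReal (H ν))
    (hinF : ∀ ν : Measure E3, ∫⁻ y, F (ν.map fun z : E3 => z - y) (-y) ∂ν =
      ∫⁻ y in closedBall (0 : E3) r, ENNReal.ofReal (H (ν.map fun z : E3 => z - y)) / (ν.map fun z : E3 => z - y) (closedBall (0 : E3) r) ∂ν)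
    {G : Measure E3 → E3 → ℝ≥0∞}
    (houtG : ∀ ν : Measure E3, IsRootedHardCore (7 / 10) ν → ∫⁻ y, G ν y ∂ν = ENNReal.ofReal (250 / 12 * (10 / 7) ^ 6))
    (hinG : ∀ ν : Measure E3, ∫⁻ y, G (ν.map fun z : E3 => z - y) (-y) ∂ν =
      ∫⁻ y in closedBall (0 : E3) r, ENNReal.ofReal (250 / 12 * (10 / 7) ^ 6) / (ν.map fun z : E3 => z - y) (closedBall (0 : E3) r) ∂ν)
    {μ : Measure E3} (hμ : IsRootedHardCore (7 / 10) μ) :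
    rootEnergy lennardJones μ + net F G μ = shareAvgEnergy r μ := by
  have h7 : (0 : ℝ) < 7 / 10 := by norm_num
  have hc : (0 : ℝ) ≤ 250 / 12 * (10 / 7) ^ 6 := by positivity
  have hc0 := rootEnergy_add_c0_nonneg hμ
  have houtF' : (∫⁻ y, F μ y ∂μ).toReal = rootEnergy lennardJones μ + 250 / 12 * (10 / 7) ^ 6 := by
    rw [houtF μ hμ, hH μ hμ, sub_neg_eq_add, ENNReal.toReal_ofReal hc0]
  have houtG' : (∫⁻ y, G μ y ∂μ).toReal = 250 / 12 * (10 / 7) ^ 6 := by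
    rw [houtG μ hμ, ENNReal.toReal_ofReal hc]
  have hinF' : ∫⁻ y, F (μ.map fun z : E3 => z - y) (-y) ∂μ =
      ∫⁻ y in closedBall (0 : E3) r, ENNReal.ofReal (rootEnergy lennardJones (μ.map fun z : E3 => z - y) + 250 / 12 * (10 / 7) ^ 6) /
        (μ.map fun z : E3 => z - y) (closedBall (0 : E3) r) ∂μ := by
    rw [hinF μ]
    refine lintegral_congr_ae (ae_restrict_of_ae ?_)
    filter_upwards [ae_apply_singleton_ne_zero h7 hμ] with y hy
    rw [hH _ (hμ.map_sub hy), sub_neg_eq_add]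
  unfold net shareAvgEnergy
  rw [houtF', houtG', hinF', hinG μ]
  ring

/-- The balanced pair is an admissible NULL LEDGER: jointly measurable transports with out-flows `≤ C₀ + c₀` (by `rootEnergy_le_C0`) and `= c₀` on rooted
`7/10`-hard-core configurations ⟹ `net F G` is integrable with mean `≤ 0` under every point-stationary probability law a.s. carried by such configurations
(#132 `net_nullLedger`, by name). [folklore: mass transport] -/
theorem balanced_nullLedger {H : Measure E3 → ℝ}
    (hH : ∀ ν : Measure E3, IsRootedHardCore (7 / 10) ν → H ν = rootEnergy lennardJones ν - (-(250 / 12 * (10 / 7) ^ 6)))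
    {F : Measure E3 → E3 → ℝ≥0∞} (hF : Measurable (Function.uncurry F))
    (houtF : ∀ ν : Measure E3, IsRootedHardCore (7 / 10) ν → ∫⁻ y, F ν y ∂ν = ENNReal.ofReal (H ν))
    {G : Measure E3 → E3 → ℝ≥0∞} (hG : Measurable (Function.uncurry G))
    (houtG : ∀ ν : Measure E3, IsRootedHardCore (7 / 10) ν → ∫⁻ y, G ν y ∂ν = ENNReal.ofReal (250 / 12 * (10 / 7) ^ 6)) :
    ∀ P : Measure (Measure E3), IsProbabilityMeasure P → (∀ᵐ μ ∂P, IsRootedHardCore (7 / 10) μ) → IsPointStationaryLaw P →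
      Integrable (net F G) P ∧ ∫ μ, net F G μ ∂P ≤ 0 := by
  refine net_nullLedger F G hF hG (BF := ENNReal.ofReal (250 / 24 * (10 / 7) ^ 12 + 250 / 12 * (10 / 7) ^ 6))
    (BG := ENNReal.ofReal (250 / 12 * (10 / 7) ^ 6)) ENNReal.ofReal_ne_top ENNReal.ofReal_ne_top (fun μ hμ => ?_) (fun μ hμ => ?_)
  · rw [houtF μ hμ, hH μ hμ, sub_neg_eq_add]
    exact ENNReal.ofReal_le_ofReal (by linarith [rootEnergy_le_C0 hμ])
  · rw [houtG μ hμ]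

/-! ## §2. The reach theorem and the energy–mass inequality in SHARE currency -/

/-- ★★ **THE REACH THEOREM WITH THE BALANCED SHARING LEDGER.**  For any radius `r > 0`: row floors `e⋆ + m_i ≤ shareAvgEnergy r μ` at the rooted
`7/10`-hard-core Nash configurations of row `i < n` (margins `≥ m > 0`), and the cap `e⋆ − shareAvgEnergy r μ ≤ D` (`D ≥ 0`) ONLY at rooted `7/10`-hard-core
Nash configurations outside every row, prove F(η) for every `η ≤ reach m D` — #132 `coherentMassExclusion_of_floorsL` with `Φ := net F G`, `F`/`G` the tree's
sharing transports of the shifted energy and of the constant shift. [new: junction] -/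
theorem coherentMassExclusion_of_shareAvg {r : ℝ} (hr : 0 < r) (n : ℕ) (K : ℕ → Set (MeasureTheory.Measure (EuclideanSpace ℝ (Fin 3))))
    (hK : ∀ i, MeasurableSet (K i)) (mK : ℕ → ℝ)
    (hfloorA : ∀ i < n, ∀ μ : Measure E3, IsRootedHardCore (7 / 10) μ →
      (∀ p : E3, μ {p} ≠ 0 → ∀ y : E3, (∀ q : E3, μ {q} ≠ 0 → q ≠ p → y ≠ q) →
        ∑' q : {q : E3 // μ {q} ≠ 0 ∧ q ≠ p}, lennardJones (dist p (q : E3)) ≤ ∑' q : {q : E3 // μ {q} ≠ 0 ∧ q ≠ p}, lennardJones (dist y (q : E3))) →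
      μ ∈ K i → eStar + mK i ≤ shareAvgEnergy r μ)
    {m D : ℝ} (hm0 : 0 < m) (hD : 0 ≤ D) (hm : ∀ i < n, m ≤ mK i)
    (hcapA : ∀ μ : Measure E3, IsRootedHardCore (7 / 10) μ →
      (∀ p : E3, μ {p} ≠ 0 → ∀ y : E3, (∀ q : E3, μ {q} ≠ 0 → q ≠ p → y ≠ q) →
        ∑' q : {q : E3 // μ {q} ≠ 0 ∧ q ≠ p}, lennardJones (dist p (q : E3)) ≤ ∑' q : {q : E3 // μ {q} ≠ 0 ∧ q ≠ p}, lennardJones (dist y (q : E3))) →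
      μ ∉ (⋃ i ∈ Finset.range n, K i) → eStar - shareAvgEnergy r μ ≤ D)
    {η : ℝ} (hη : η ≤ reach m D) : CoherentMassExclusion n K η := by
  obtain ⟨H, hHm, hH⟩ := exists_measurable_rootEnergy_surrogate (-(250 / 12 * (10 / 7) ^ 6))
  obtain ⟨F, hF, houtF, hinF⟩ := sharing_transport (ENNReal.measurable_ofReal.comp hHm) hr
  obtain ⟨G, hG, houtG, hinG⟩ :=
    sharing_transport (g := fun _ : Measure E3 => ENNReal.ofReal (250 / 12 * (10 / 7) ^ 6)) measurable_const hr
  refine coherentMassExclusion_of_floorsL n K hK mK (net F G) (balanced_nullLedger hH hF houtF hG houtG) (fun i hi μ hμ hN hμi => ?_) hm0 hD hm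
    (fun μ hμ hN hμU => ?_) hη
  · rw [transported_eq_shareAvgEnergy hH houtF hinF houtG hinG hμ]
    exact hfloorA i hi μ hμ hN hμi
  · rw [sub_sub, transported_eq_shareAvgEnergy hH houtF hinF houtG hinG hμ]
    exact hcapA μ hμ hN hμU

/-- ★ JUNCTION TO THE CRUX: share-currency floors, the share-currency cap off the rows, and A(η) = `OffAtlasMassGap n K η` (`η ≤ reach m D`) prove
`AperiodicFrustratedLawGap` ((404) `aperiodicFrustratedLawGap_of_massSplit`, by name). [new: junction] -/
theorem aperiodicFrustratedLawGap_of_offAtlasMassGap_shareAvg {r : ℝ} (hr : 0 < r) (n : ℕ)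
    (K : ℕ → Set (MeasureTheory.Measure (EuclideanSpace ℝ (Fin 3)))) (hK : ∀ i, MeasurableSet (K i)) (mK : ℕ → ℝ)
    (hfloorA : ∀ i < n, ∀ μ : Measure E3, IsRootedHardCore (7 / 10) μ →
      (∀ p : E3, μ {p} ≠ 0 → ∀ y : E3, (∀ q : E3, μ {q} ≠ 0 → q ≠ p → y ≠ q) →
        ∑' q : {q : E3 // μ {q} ≠ 0 ∧ q ≠ p}, lennardJones (dist p (q : E3)) ≤ ∑' q : {q : E3 // μ {q} ≠ 0 ∧ q ≠ p}, lennardJones (dist y (q : E3))) →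
      μ ∈ K i → eStar + mK i ≤ shareAvgEnergy r μ)
    {m D : ℝ} (hm0 : 0 < m) (hD : 0 ≤ D) (hm : ∀ i < n, m ≤ mK i)
    (hcapA : ∀ μ : Measure E3, IsRootedHardCore (7 / 10) μ →
      (∀ p : E3, μ {p} ≠ 0 → ∀ y : E3, (∀ q : E3, μ {q} ≠ 0 → q ≠ p → y ≠ q) →
        ∑' q : {q : E3 // μ {q} ≠ 0 ∧ q ≠ p}, lennardJones (dist p (q : E3)) ≤ ∑' q : {q : E3 // μ {q} ≠ 0 ∧ q ≠ p}, lennardJones (dist y (q : E3))) →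
      μ ∉ (⋃ i ∈ Finset.range n, K i) → eStar - shareAvgEnergy r μ ≤ D)
    {η : ℝ} (hη : η ≤ reach m D) (hA : OffAtlasMassGap n K η) :
    Summit.AtomisticToContinuum.Crystallization.Theses.FrustratedLawDichotomy.AperiodicFrustratedLawGap :=
  aperiodicFrustratedLawGap_of_massSplit n K η (coherentMassExclusion_of_shareAvg hr n K hK mK hfloorA hm0 hD hm hcapA hη) hA

/-- ★ THE ENERGY–MASS INEQUALITY IN SHARE CURRENCY (#132 §4 with the balanced ledger): share-currency row floors (margins `≥ m`), the share-currency cap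
off the rows, `0 < m + D` ⟹ every point-stationary probability law that is a.s. rooted `7/10`-hard-core and a.s. Nash with `E_P[rootEnergy] ≤ e⋆ + ε`
gives the uncovered set mass `≥ (m − ε)/(m + D)` — clauses (a)(b)(e) only. [new: junction] -/
theorem offAtlasMass_ge_of_shareAvg {r : ℝ} (hr : 0 < r) (n : ℕ) (K : ℕ → Set (MeasureTheory.Measure (EuclideanSpace ℝ (Fin 3))))
    (hK : ∀ i, MeasurableSet (K i)) (mK : ℕ → ℝ)
    (hfloorA : ∀ i < n, ∀ μ : Measure E3, IsRootedHardCore (7 / 10) μ →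
      (∀ p : E3, μ {p} ≠ 0 → ∀ y : E3, (∀ q : E3, μ {q} ≠ 0 → q ≠ p → y ≠ q) →
        ∑' q : {q : E3 // μ {q} ≠ 0 ∧ q ≠ p}, lennardJones (dist p (q : E3)) ≤ ∑' q : {q : E3 // μ {q} ≠ 0 ∧ q ≠ p}, lennardJones (dist y (q : E3))) →
      μ ∈ K i → eStar + mK i ≤ shareAvgEnergy r μ)
    {m D : ℝ} (hmD : 0 < m + D) (hm : ∀ i < n, m ≤ mK i)
    (hcapA : ∀ μ : Measure E3, IsRootedHardCore (7 / 10) μ →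
      (∀ p : E3, μ {p} ≠ 0 → ∀ y : E3, (∀ q : E3, μ {q} ≠ 0 → q ≠ p → y ≠ q) →
        ∑' q : {q : E3 // μ {q} ≠ 0 ∧ q ≠ p}, lennardJones (dist p (q : E3)) ≤ ∑' q : {q : E3 // μ {q} ≠ 0 ∧ q ≠ p}, lennardJones (dist y (q : E3))) →
      μ ∉ (⋃ i ∈ Finset.range n, K i) → eStar - shareAvgEnergy r μ ≤ D)
    (P : Measure (Measure E3)) [IsProbabilityMeasure P] (ha : ∀ᵐ μ ∂P, IsRootedHardCore (7 / 10) μ) (hb : IsPointStationaryLaw P)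
    (he : ∀ᵐ μ ∂P, ∀ p : E3, μ {p} ≠ 0 → ∀ y : E3, (∀ q : E3, μ {q} ≠ 0 → q ≠ p → y ≠ q) →
      ∑' q : {q : E3 // μ {q} ≠ 0 ∧ q ≠ p}, lennardJones (dist p (q : E3)) ≤ ∑' q : {q : E3 // μ {q} ≠ 0 ∧ q ≠ p}, lennardJones (dist y (q : E3)))
    {ε : ℝ} (hmean : ∫ μ, rootEnergy lennardJones μ ∂P ≤ eStar + ε) :
    (m - ε) / (m + D) ≤ P.real (⋃ i ∈ Finset.range n, K i)ᶜ := by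
  obtain ⟨H, hHm, hH⟩ := exists_measurable_rootEnergy_surrogate (-(250 / 12 * (10 / 7) ^ 6))
  obtain ⟨F, hF, houtF, hinF⟩ := sharing_transport (ENNReal.measurable_ofReal.comp hHm) hr
  obtain ⟨G, hG, houtG, hinG⟩ :=
    sharing_transport (g := fun _ : Measure E3 => ENNReal.ofReal (250 / 12 * (10 / 7) ^ 6)) measurable_const hr
  refine offAtlasMass_ge_of_floorsL n K hK mK (net F G) (balanced_nullLedger hH hF houtF hG houtG) (fun i hi μ hμ hN hμi => ?_) hmD hm
    (fun μ hμ hN hμU => ?_) P ha hb he hmean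
  · rw [transported_eq_shareAvgEnergy hH houtF hinF houtG hinG hμ]
    exact hfloorA i hi μ hμ hN hμi
  · rw [sub_sub, transported_eq_shareAvgEnergy hH houtF hinF houtG hinG hμ]
    exact hcapA μ hμ hN hμU

/-! ## §3. Evaluation on counting configurations: the functionals ARE the displayed finite sums -/

section Eval

variable {S : Set E3}

/-- Ball counts of a `7/10`-separated counting configuration: `count|S (B̄_r(y)) = (B̄_r(y) ∩ S).ncard`. [folklore] -/
theorem count_restrict_closedBall_eq_ncard (hsep : ∀ a ∈ S, ∀ b ∈ S, a ≠ b → (7 : ℝ) / 10 ≤ dist a b) (y : E3) (r : ℝ) :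
    (Measure.count : Measure E3).restrict S (closedBall y r) = ((closedBall y r ∩ S).ncard : ℝ≥0∞) := by
  have hfin : (closedBall y r ∩ S).Finite := finite_inter_of_separated (by norm_num) hsep (isCompact_closedBall y r)
  rw [Measure.restrict_apply measurableSet_closedBall, Measure.count_apply_finite _ hfin, Set.ncard_eq_toFinset_card _ hfin]

/-- A set `lintegral` over a closed ball against a `7/10`-separated counting configuration is a finite sum. [folklore] -/
theorem setLIntegral_count_restrict_eq_sum (hsep : ∀ a ∈ S, ∀ b ∈ S, a ≠ b → (7 : ℝ) / 10 ≤ dist a b) {r : ℝ}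
    (hfin : (closedBall (0 : E3) r ∩ S).Finite) (f : E3 → ℝ≥0∞) :
    ∫⁻ y in closedBall (0 : E3) r, f y ∂(Measure.count : Measure E3).restrict S = ∑ y ∈ hfin.toFinset, f y := by
  have _ := hsep
  rw [Measure.restrict_restrict measurableSet_closedBall]
  have hcoe : (Measure.count : Measure E3).restrict (closedBall (0 : E3) r ∩ S) =
      (Measure.count : Measure E3).restrict (↑hfin.toFinset : Set E3) := by rw [Finite.coe_toFinset]
  rw [hcoe, lintegral_finset]
  simp only [Measure.count_singleton, mul_one]

/-- Every point of the ball `B̄_r(0) ∩ S` has a positive ball count `(B̄_r(y) ∩ S).ncard ≥ 1` (it counts itself). [folklore] -/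
theorem one_le_ncard_of_mem (hsep : ∀ a ∈ S, ∀ b ∈ S, a ≠ b → (7 : ℝ) / 10 ≤ dist a b) {r : ℝ} {y : E3}
    (hy : y ∈ closedBall (0 : E3) r ∩ S) : 1 ≤ (closedBall y r ∩ S).ncard := by
  have hfin : (closedBall y r ∩ S).Finite := finite_inter_of_separated (by norm_num) hsep (isCompact_closedBall y r)
  have hr : 0 ≤ r := by
    have h := hy.1
    rw [mem_closedBall] at h
    exact le_trans dist_nonneg h
  have hyy : y ∈ closedBall y r ∩ S := ⟨mem_closedBall_self hr, hy.2⟩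
  rw [Nat.one_le_iff_ne_zero, Ne, Set.ncard_eq_zero hfin]
  exact fun h => (h ▸ hyy : y ∈ (∅ : Set E3))

/-- ★ EVALUATION OF THE BALL WEIGHT: `ballWeight r (count|S) = Σ_{y ∈ B̄_r(0) ∩ S} 1/(B̄_r(y) ∩ S).ncard`. [folklore] -/
theorem ballWeight_eq_sum (hsep : ∀ a ∈ S, ∀ b ∈ S, a ≠ b → (7 : ℝ) / 10 ≤ dist a b) {r : ℝ}
    (hfin : (closedBall (0 : E3) r ∩ S).Finite) :
    ballWeight r ((Measure.count : Measure E3).restrict S) = ∑ y ∈ hfin.toFinset, ((closedBall y r ∩ S).ncard : ℝ)⁻¹ := by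
  unfold ballWeight
  rw [setLIntegral_count_restrict_eq_sum hsep hfin, ENNReal.toReal_sum (fun y hy => ?_)]
  · refine Finset.sum_congr rfl fun y hy => ?_
    rw [map_sub_apply_closedBall, count_restrict_closedBall_eq_ncard hsep, ENNReal.toReal_inv, ENNReal.toReal_natCast]
  · rw [map_sub_apply_closedBall, count_restrict_closedBall_eq_ncard hsep]
    have h1 := one_le_ncard_of_mem hsep ((Finite.mem_toFinset hfin).1 hy)
    exact ENNReal.inv_ne_top.2 (by exact_mod_cast (by omega : (closedBall y r ∩ S).ncard ≠ 0))

/-- ★★ EVALUATION OF THE SHARE: on a rooted `7/10`-hard-core counting configuration `count|S` (`0 ∈ S`),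
`shareAvgEnergy r (count|S) = Σ_{y ∈ B̄_r(0) ∩ S} rootEnergy(θ_y count|S) / (B̄_r(y) ∩ S).ncard` — no `c₀` term. [folklore] -/
theorem shareAvgEnergy_eq_sum (h0 : (0 : E3) ∈ S) (hsep : ∀ a ∈ S, ∀ b ∈ S, a ≠ b → (7 : ℝ) / 10 ≤ dist a b) {r : ℝ}
    (hfin : (closedBall (0 : E3) r ∩ S).Finite) :
    shareAvgEnergy r ((Measure.count : Measure E3).restrict S) =
      ∑ y ∈ hfin.toFinset, rootEnergy lennardJones (((Measure.count : Measure E3).restrict S).map fun z : E3 => z - y) /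
        ((closedBall y r ∩ S).ncard : ℝ) := by
  have hμ : IsRootedHardCore (7 / 10) ((Measure.count : Measure E3).restrict S) := ⟨S, h0, hsep, rfl⟩
  have hc : (0 : ℝ) ≤ 250 / 12 * (10 / 7) ^ 6 := by positivity
  have hne : ∀ y ∈ hfin.toFinset, ((closedBall y r ∩ S).ncard : ℝ≥0∞) ≠ 0 := fun y hy => by
    have h1 := one_le_ncard_of_mem hsep ((Finite.mem_toFinset hfin).1 hy)
    exact_mod_cast (by omega : (closedBall y r ∩ S).ncard ≠ 0)
  have hyS : ∀ y ∈ hfin.toFinset, ((Measure.count : Measure E3).restrict S) {y} ≠ 0 := fun y hy =>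
    (count_restrict_singleton_ne_zero_iff S y).2 ((Finite.mem_toFinset hfin).1 hy).2
  unfold shareAvgEnergy
  rw [setLIntegral_count_restrict_eq_sum hsep hfin, setLIntegral_count_restrict_eq_sum hsep hfin,
    ENNReal.toReal_sum (fun y hy => ?_), ENNReal.toReal_sum (fun y hy => ?_), ← Finset.sum_sub_distrib]
  · refine Finset.sum_congr rfl fun y hy => ?_
    rw [map_sub_apply_closedBall, count_restrict_closedBall_eq_ncard hsep, ENNReal.toReal_div, ENNReal.toReal_div,
      ENNReal.toReal_ofReal (rootEnergy_add_c0_nonneg (hμ.map_sub (hyS y hy))), ENNReal.toReal_ofReal hc, ENNReal.toReal_natCast]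
    ring
  · rw [map_sub_apply_closedBall, count_restrict_closedBall_eq_ncard hsep]
    exact ENNReal.div_ne_top ENNReal.ofReal_ne_top (hne y hy)
  · rw [map_sub_apply_closedBall, count_restrict_closedBall_eq_ncard hsep]
    exact ENNReal.div_ne_top ENNReal.ofReal_ne_top (hne y hy)

/-- EVALUATION OF #134's functional: `ballAvgEnergy r (count|S) = Σ_{y ∈ B̄_r(0) ∩ S} (rootEnergy(θ_y count|S) + c₀)/(B̄_r(y) ∩ S).ncard − c₀`
(so the `c₀` terms cancel iff `Σ_y 1/(B̄_r(y) ∩ S).ncard = 1`). [folklore] -/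
theorem ballAvgEnergy_eq_sum (h0 : (0 : E3) ∈ S) (hsep : ∀ a ∈ S, ∀ b ∈ S, a ≠ b → (7 : ℝ) / 10 ≤ dist a b) {r : ℝ}
    (hfin : (closedBall (0 : E3) r ∩ S).Finite) :
    ballAvgEnergy r ((Measure.count : Measure E3).restrict S) =
      ∑ y ∈ hfin.toFinset, (rootEnergy lennardJones (((Measure.count : Measure E3).restrict S).map fun z : E3 => z - y) +
        250 / 12 * (10 / 7) ^ 6) / ((closedBall y r ∩ S).ncard : ℝ) - 250 / 12 * (10 / 7) ^ 6 := by
  rw [ballAvgEnergy_eq_shareAvgEnergy_add, shareAvgEnergy_eq_sum h0 hsep hfin, ballWeight_eq_sum hsep hfin]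
  simp only [div_eq_mul_inv, add_mul, mul_sub, Finset.mul_sum, Finset.sum_add_distrib]
  ring

end Eval

end Summit.AtomisticToContinuum.Crystallization.Theorems.FrustratedLawDichotomyAtlasReachSharingBalanced

end
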